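import Summits.KontsevichZagierPeriods.KontsevichZagierPeriods.Theses.HyperbolicBloch

/-!
# drefute evidence — line `bruhat-inversion-chain` of crux `IsometryMove` (stmt-KontsevichZagierPeriods-3471)

Refuter `refuter-drefute-stmt-KontsevichZagierPeriods-3471-0`, attacking the stub set of
`Cruxes/IsometryMove/Lines/bruhat-inversion-chain.lean` (5 stubs).  `lean check`: rc 0, 0 sorry, 0 warnings,
axioms ⊆ {propext, Classical.choice, Quot.sound}.

Outcome: 0 stub-false, 0 stub-misstated, 5 survived; two of the five are PROVED here verbatim
(`stub_affineCase_proof`, `stub_bruhatFactorisation_proof` — candidate proofs for the lead to paste), and one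
mutation finding is recorded as a lemma (`mapsTo_of_density`: the `MapsTo Φ r.domain {t > 0}` hypothesis of
`stub_moveTransport` follows from `r.domain ⊆ {t > 0}` and the density identity, i.e. it is redundant).
The remaining three stubs (`stub_similarityMove`, `stub_inversionMove`, `stub_moveTransport`) survive every cheap
attack (see the drefute summary note on the item): exact rational checks of `det DS = η‖α‖³`,
`J ∘ J = id`, `det DJ = +|p|⁻⁶`, and the density identities; hypotheses satisfiable; no junk-model instance.
-/

open Set

namespace Summit.KontsevichZagierPeriods.HyperbolicBloch.IsometryMove.Drefute

/-- Mutation finding for `stub_moveTransport`: the hypothesis `MapsTo Φ r.domain {t > 0}` is implied by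
`r.domain ⊆ {t > 0}` and the density identity `1/t³ = 1/(Φ p)₃³ · |det DΦ|` (so it is redundant there). -/
theorem mapsTo_of_density {σ : Set (Fin 3 → ℝ)} (hσ : σ ⊆ {p | 0 < p 2})
    (Φ : (Fin 3 → ℝ) → (Fin 3 → ℝ)) (D : (Fin 3 → ℝ) → ℝ)
    (h : ∀ x ∈ σ, 1 / x 2 ^ 3 = 1 / (Φ x) 2 ^ 3 * |D x|) : MapsTo Φ σ {p | 0 < p 2} := by
  intro x hx
  have hx2 : 0 < x 2 := hσ hx
  have h1 : 0 < 1 / x 2 ^ 3 := by positivity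
  rw [h x hx] at h1
  have h2 : 0 < 1 / (Φ x) 2 ^ 3 := by
    rcases mul_pos_iff.mp h1 with ⟨ha, _⟩ | ⟨_, hb⟩
    · exact ha
    · exact absurd hb (not_lt.mpr (abs_nonneg _))
  have h3 : 0 < (Φ x) 2 ^ 3 := one_div_pos.mp h2
  exact (Odd.pow_pos_iff (by decide)).mp h3

/-- `stub_affineCase` of `Lines/bruhat-inversion-chain.lean`, PROVED (signature verbatim): for `c = 0`, `d ≠ 0`
the typed Poincaré extension is the similarity `S(a/d, b/d, ε)` at EVERY point (no `t > 0` needed).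
Script: `subst c; field_simp` the affine form, then componentwise `simp [Complex.div_re/div_im, …]; field_simp; ring`. -/
theorem stub_affineCase_proof : ∀ (a b c d : ℂ) (ε : ℝ), c = 0 → d ≠ 0 → ∀ (S : (Fin 3 → ℝ) → (Fin 3 → ℝ)), (∀ p, S p = ![((a / d) * (Complex.mk (p 0) (ε * p 1)) + b / d).re, ((a / d) * (Complex.mk (p 0) (ε * p 1)) + b / d).im, ‖a / d‖ * p 2]) → ∀ (p : Fin 3 → ℝ), (![((a * (Complex.mk (p 0) (ε * p 1)) + b) * (starRingEnd ℂ) (c * (Complex.mk (p 0) (ε * p 1)) + d) + a * (starRingEnd ℂ) c * (p 2 : ℂ) ^ 2).re / (Complex.normSq (c * (Complex.mk (p 0) (ε * p 1)) + d) + Complex.normSq c * p 2 ^ 2), ((a * (Complex.mk (p 0) (ε * p 1)) + b) * (starRingEnd ℂ) (c * (Complex.mk (p 0) (ε * p 1)) + d) + a * (starRingEnd ℂ) c * (p 2 : ℂ) ^ 2).im / (Complex.normSq (c * (Complex.mk (p 0) (ε * p 1)) + d) + Complex.normSq c * p 2 ^ 2), ‖a * d - b * c‖ * p 2 / (Complex.normSq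 (c * (Complex.mk (p 0) (ε * p 1)) + d) + Complex.normSq c * p 2 ^ 2)] : Fin 3 → ℝ) = S p := by
  intro a b c d ε hc hd S hS p
  subst hc
  rw [hS p]
  have hd' : Complex.normSq d ≠ 0 := by rwa [Ne, Complex.normSq_eq_zero]
  have hdn : ‖d‖ ≠ 0 := norm_ne_zero_iff.mpr hd
  have hdiv : a / d * (Complex.mk (p 0) (ε * p 1)) + b / d = (a * (Complex.mk (p 0) (ε * p 1)) + b) / d := by
    field_simp
  rw [hdiv]
  simp only [zero_mul, zero_add, mul_zero, sub_zero, map_zero, add_zero]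
  ext i
  fin_cases i
  · simp [Complex.div_re, Complex.mul_re, Complex.mul_im, Complex.conj_re, Complex.conj_im]
    field_simp
  · simp [Complex.div_im, Complex.mul_re, Complex.mul_im, Complex.conj_re, Complex.conj_im]
    field_simp
    ring
  · simp [Complex.normSq_eq_norm_sq]
    field_simp


/-- `stub_bruhatFactorisation` of `Lines/bruhat-inversion-chain.lean`, PROVED (signature verbatim): on `{t > 0}`,
`c ≠ 0`, the typed map is `S(−(ad−bc)/c, a/c, 1) ∘ J ∘ S(c, d, ε)`.  Proof: the denominator of `J` at `S₁ p` is
`N = |cw+d|² + |c|²t²` (`hn`); the complex identity `num/N = (−K/c)·conj(cw+d)/N + a/c` (`key`, one `ring`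
after clearing denominators with `↑N = (cw+d)·conj(cw+d) + c·conj c·t²`); components 0,1 are its re/im parts,
component 2 is `‖K‖t/N = (‖K‖/‖c‖)·(‖c‖t/N)`.  NB the stub (rightly) carries no `ad − bc ≠ 0` and no `ε = ±1`
hypothesis — the identity holds for all `a b d ε`; `0 < p 2` is used only to make `N ≠ 0`. -/
theorem stub_bruhatFactorisation_proof : ∀ (a b c d : ℂ) (ε : ℝ), c ≠ 0 → ∀ (S₁ J S₂ : (Fin 3 → ℝ) → (Fin 3 → ℝ)), (∀ p, S₁ p = ![(c * (Complex.mk (p 0) (ε * p 1)) + d).re, (c * (Complex.mk (p 0) (ε * p 1)) + d).im, ‖c‖ * p 2]) → (∀ p, J p = ![p 0 / (p 0 ^ 2 + p 1 ^ 2 + p 2 ^ 2), -p 1 / (p 0 ^ 2 + p 1 ^ 2 + p 2 ^ 2), p 2 / (p 0 ^ 2 + p 1 ^ 2 + p 2 ^ 2)]) → (∀ p, S₂ p = ![((-(a * d - b * c) / c) * (Complex.mk (p 0) (1 * p 1)) + a / c).re, ((-(a * d - b * c) / c) * (Complex.mk (p 0) (1 * p 1)) + a / c).im, ‖-(a * d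 - b * c) / c‖ * p 2]) → ∀ (p : Fin 3 → ℝ), 0 < p 2 → (![((a * (Complex.mk (p 0) (ε * p 1)) + b) * (starRingEnd ℂ) (c * (Complex.mk (p 0) (ε * p 1)) + d) + a * (starRingEnd ℂ) c * (p 2 : ℂ) ^ 2).re / (Complex.normSq (c * (Complex.mk (p 0) (ε * p 1)) + d) + Complex.normSq c * p 2 ^ 2), ((a * (Complex.mk (p 0) (ε * p 1)) + b) * (starRingEnd ℂ) (c * (Complex.mk (p 0) (ε * p 1)) + d) + a * (starRingEnd ℂ) c * (p 2 : ℂ) ^ 2).im / (Complex.normSq (c * (Complex.mk (p 0) (ε * p 1)) + d) + Complex.normSq c * p 2 ^ 2), ‖a * d - b * c‖ * p 2 / (Complex.normSq (c * (Complex.mk (p 0) (ε * p 1)) + d) + Complex.normSq c * p 2 ^ 2)] : Fin 3 → ℝ) = S₂ (J (S₁ p)) := by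
  intro a b c d ε hc S₁ J S₂ hS₁ hJ hS₂ p hp
  set w : ℂ := Complex.mk (p 0) (ε * p 1) with hw
  set N : ℝ := Complex.normSq (c * w + d) + Complex.normSq c * p 2 ^ 2 with hN
  have hNpos : 0 < N := by
    have h1 : 0 < Complex.normSq c * p 2 ^ 2 := mul_pos (Complex.normSq_pos.mpr hc) (by positivity)
    have h2 := Complex.normSq_nonneg (c * w + d)
    linarith
  have hN0 : N ≠ 0 := hNpos.ne'
  have hc' : ‖c‖ ≠ 0 := norm_ne_zero_iff.mpr hc
  -- the denominator of `J` at `S₁ p` is `N`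
  have hn : (c * w + d).re ^ 2 + (c * w + d).im ^ 2 + (‖c‖ * p 2) ^ 2 = N := by
    rw [hN, Complex.normSq_apply, mul_pow, Complex.sq_norm, Complex.normSq_apply]; ring
  have hJq : J (S₁ p) = ![(c * w + d).re / N, -(c * w + d).im / N, ‖c‖ * p 2 / N] := by
    rw [hJ, hS₁ p]
    simp only [Matrix.cons_val_zero, Matrix.cons_val_one, Matrix.head_cons, Matrix.cons_val_two,
      Matrix.tail_cons]
    rw [hn]
  rw [hS₂, hJq]
  simp only [Matrix.cons_val_zero, Matrix.cons_val_one, Matrix.head_cons, Matrix.cons_val_two,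
    Matrix.tail_cons, one_mul]
  -- the key complex identity `num / N = (-K/c)·conj(cw+d)/N + a/c`
  have hNc : (N : ℂ) ≠ 0 := Complex.ofReal_ne_zero.mpr hN0
  have hNeq : (N : ℂ) = (c * w + d) * (starRingEnd ℂ) (c * w + d) + c * (starRingEnd ℂ) c * (p 2 : ℂ) ^ 2 := by
    rw [Complex.mul_conj, Complex.mul_conj, hN]; push_cast; ring
  have key : ((a * w + b) * (starRingEnd ℂ) (c * w + d) + a * (starRingEnd ℂ) c * (p 2 : ℂ) ^ 2) / (N : ℂ)
      = (-(a * d - b * c) / c) * ((starRingEnd ℂ) (c * w + d) / (N : ℂ)) + a / c := by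
    rw [eq_comm, div_mul_div_comm, div_add_div _ _ (mul_ne_zero hc hNc) hc, div_eq_div_iff
      (mul_ne_zero (mul_ne_zero hc hNc) hc) hNc]
    rw [hNeq]
    ring
  have hz : (starRingEnd ℂ) (c * w + d) / (N : ℂ) = Complex.mk ((c * w + d).re / N) (-(c * w + d).im / N) := by
    apply Complex.ext
    · simp [Complex.div_ofReal_re]
    · simp [Complex.div_ofReal_im]
      ring
  rw [hz] at key
  ext i
  fin_cases i
  · simpa [Complex.div_ofReal_re] using congrArg Complex.re key
  · simpa [Complex.div_ofReal_im] using congrArg Complex.im key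
  · simp only [Fin.reduceFinMk, Matrix.cons_val, norm_div, norm_neg]
    field_simp


end Summit.KontsevichZagierPeriods.HyperbolicBloch.IsometryMove.Drefute
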